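import Literature.NumberTheory.EllipticCurves.ZpExtensionCoeffAdicTower
import Literature.NumberTheory.EllipticCurves.IwasawaAlgebraEisensteinQuotientDuality
import Literature.NumberTheory.EllipticCurves.Kato2004.IwasawaCohomologyExistsProofs
import Literature.RingTheory.CompleteIntersection.MonogenicDualizingForm
import HarnessLib

/-!
# Frobenius data on Howard's Shapiro level rings `Λ/(ω_k, p^k) = (ℤ/p^k)[T]/(ω_k)`: the `ℤ_p`-power basis of
# `Λ/(ω_k)`, the tail form modulo `p^k`, the structure map `ℤ/p^k → Λ/(ω_k, p^k)`, and the dual families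

Topic `NumberTheory/EllipticCurves` (the `Λ/(ω_k, p^k)`-twin of `IwasawaAlgebraEisensteinQuotientDuality` §1–§2 and of
`ZpExtensionEisensteinTwistDualityForm` §1 for the Eisenstein rings `A_{m,k} = Λ/(T^m + p, p^k)`; sequel of x9-p2's
`ZpExtensionCoeffAdicTower` (`shapiroIdeal p k = (ω_k, p^k)`), of the tree's generic `MonogenicDualizingForm` (tail form,
dual basis, expansion formulas of a monogenic algebra over ANY base) and of `Kato2004.IwasawaCohomologyExistsProofs`
(`ω_k` is distinguished). Definitions with bodies + theorems; no named fact, no instance, no notation, no `sorry`.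

Howard [Compositio 140 (2004) §2.2 Def. 2.2.1–2.2.3, arXiv:1202.6340 p0016]: `Λ/I_k`, `I_k = (ω_k, p^k)`,
`ω_k = (1+T)^{p^k} − 1`, is the coefficient ring `ℤ/p^k[Gal(K_k/K)]` of the Shapiro level `Ind_{K_k/K} E[p^k] = E[p^k] ⊗ Λ/I_k`
of `𝐓 = lim← Ind_{K_n/K} T`. Hypothesis H.4 for the Λ-adic SOURCE triple `(𝐓, 𝓕_Λ, 𝓛)` at level `k` wants a PERFECT
`Λ/I_k`-bilinear pairing on that level (Prop. 2.2.4: «a perfect symmetric pairing `e_Λ : 𝐓 × 𝐓 → Λ(1)`»); by the generic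
`CoeffExtensionScalarFormPerfectProofs` this needs exactly FROBENIUS DATA on `𝒪 = Λ/I_k` modulo `n = p^k`: an additive
`lam : 𝒪 → ℤ/p^k`, `lam`-dual families `v, v^*` and the expansion `c = ∑ᵢ ι(lam(c v^*ᵢ)) vᵢ`. This file supplies them:

* §1 `coe_omegaPolynomial`, **`omegaAlgEquiv p k : ℤ_p[X]/(ω_k) ≃ₐ[ℤ_p] Λ/(ω_k)`** (Weierstrass division by the
  distinguished `ω_k`, Mathlib `Polynomial.IsDistinguishedAt.algEquivQuotient`), **`omegaPowerBasis p k : PowerBasis ℤ_[p]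
  (Λ/(ω_k))`** (`1, [T], …, [T]^{p^k − 1}`; `_dim = p^k`, `_gen = [T]`);
* §2 the ring maps around `Λ/(ω_k, p^k)`: `shapiroOfOmega : Λ/(ω_k) ↠ Λ/(ω_k, p^k)`, `shapiroEvalZero : Λ/(ω_k, p^k) → ℤ/p^k`
  (`[F] ↦ F(0) mod p^k`), **`charP_quotient_shapiroIdeal` (`Λ/(ω_k, p^k)` has characteristic `p^k`)**,
  **`shapiroOfZMod : ℤ/p^k →+* Λ/(ω_k, p^k)`** and `algebraMap_padicInt_quotient_shapiroIdeal` (`ℤ_p → Λ/I_k` is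
  `ℤ_p → ℤ/p^k → Λ/I_k`);
* §3 **the tail form `shapiroTailFormZMod p k : Λ/(ω_k, p^k) →ₗ[ℤ] ℤ/p^k`**, `λ_k([x]) = λ_ω([x]) mod p^k`
  (`shapiroTailFormZMod_mk`, `shapiroTailFormZMod_shapiroOfOmega`);
* §4 the families **`shapiroPowFamily p k i = [T^i]`** and **`shapiroDualFamily p k i = [xᵢ^*]`** (`i < p^k`, images of
  the power basis and of the tail-dual basis `tailDualBasis (omegaPowerBasis p k)`), the duality
  **`shapiroTailFormZMod_powFamily_mul_dualFamily`** (`λ_k([T^i] [xⱼ^*]) = δᵢⱼ`) and the expansion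
  **`eq_sum_shapiroOfZMod_tailFormZMod_mul_powFamily`** (`c = ∑ᵢ ι(λ_k(c [xᵢ^*])) [T^i]`) — verbatim the hypotheses
  `hδ`, `hexp` of `scalarForm_bijective_of_expansion`.

WHY (cell `pub/bsd-print-x9`, shared μ-crux): the H.4 datum `Dsrc : ∀ j, DualityDatum p cd (𝐓_j) (Λ/(ω_{j+1}, p^{j+1}))`
of the Shapiro SOURCE setting `S_Λ` (lit's `WeierstrassCurve.shapiroSetting … cd πbar D fs`, the setting on which CGLS 2022
Thm. 4.1.1 is typed) is assembled from this file and the generic perfectness in the sequel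
`ZpExtensionShapiroDualityDatum`. BSD is not proved by any of this.

References: [Howard2004HeegnerKolyvagin] §2.1 (the functional `𝒟_𝔭 → ℚ_p/ℤ_p`), §2.2 Def. 2.2.1–2.2.3, Prop. 2.2.4
(arXiv:1202.6340 p0016); [Washington1997] §7.1 (Prop. 7.2: Weierstrass division), §13.2 (`Λ/ω_n = ℤ_p[Γ_n]`);
[DeSmitRubinSchoof1997] Prop. 2.1 / Cor. 2.2 (tail form and dual basis of a monogenic algebra); [Lang1990] Ch. 5 §1.
-/

noncomputable section

open scoped Classical
open Polynomial

namespace Literature.NumberTheory.EllipticCurves.ZpExtension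

open Literature.RingTheory.CompleteIntersection Literature.NumberTheory.EllipticCurves.IwasawaAlgebra

variable (p : ℕ) [hp : Fact p.Prime]

/-! ## §1 The power basis `1, [T], …, [T]^{p^k-1}` of `Λ/(ω_k)` over `ℤ_p` -/

/-- The power series of the polynomial `ω_k = (X + 1)^{p^k} − 1` is `(1 + T)^{p^k} − 1` (the generator of the tree's
`shapiroIdeal`). [cite: Washington1997, §7.1 and §13.2 (ω_n)] -/
theorem coe_omegaPolynomial (k : ℕ) :
    (((X + 1 : ℤ_[p][X]) ^ p ^ k - 1 : ℤ_[p][X]) : IwasawaAlgebra p) =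
      (1 + PowerSeries.X : IwasawaAlgebra p) ^ (p ^ k) - 1 := by
  rw [Polynomial.coe_sub, Polynomial.coe_pow, Polynomial.coe_add, Polynomial.coe_X, Polynomial.coe_one, add_comm]

/-- `ω_k` has degree `p^k` (the Summits-side `…Theorems.UniversalToricDescentTorsionFreeByCount.natDegree_omega` is the same
computation, not importable into `Literature`). [cite: Washington1997, §7.1 and §13.2 (ω_n)] -/
theorem natDegree_omegaPolynomial (k : ℕ) : ((X + 1 : ℤ_[p][X]) ^ p ^ k - 1).natDegree = p ^ k := by
  have hX1 : (X + 1 : ℤ_[p][X]).natDegree = 1 := by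
    rw [← Polynomial.C_1, Polynomial.natDegree_X_add_C]
  have hpow : ((X + 1 : ℤ_[p][X]) ^ p ^ k).natDegree = p ^ k := by
    rw [Polynomial.natDegree_pow, hX1, mul_one]
  rw [Polynomial.natDegree_sub_eq_left_of_natDegree_lt, hpow]
  rw [hpow, Polynomial.natDegree_one]
  exact pow_pos hp.out.pos k

/-- **`ℤ_p[X]/(ω_k) ≃ₐ[ℤ_p] Λ/(ω_k)`** — Weierstrass division by the distinguished polynomial `ω_k` (tree
`Kato2004.IwasawaH1Exists.isDistinguishedAt_omega`, Mathlib `Polynomial.IsDistinguishedAt.algEquivQuotient`), followed by the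
identification of the power series of `ω_k`. [cite: Washington1997, §7.1 (Prop. 7.2)] [cite: Howard2004HeegnerKolyvagin, §2.2 Def. 2.2.1 (Λ/ω_k)] -/
def omegaAlgEquiv (k : ℕ) :
    AdjoinRoot ((X + 1 : ℤ_[p][X]) ^ p ^ k - 1) ≃ₐ[ℤ_[p]]
      IwasawaAlgebra p ⧸ Ideal.span {((1 + PowerSeries.X : IwasawaAlgebra p) ^ (p ^ k) - 1)} :=
  (Kato2004.IwasawaH1Exists.isDistinguishedAt_omega p k).algEquivQuotient.trans
    (Ideal.quotientEquivAlgOfEq ℤ_[p] (by rw [coe_omegaPolynomial]))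

/-- The isomorphism sends the class of a polynomial to the class of its power series. [cite: Washington1997, §7.1 (Prop. 7.2)] -/
theorem omegaAlgEquiv_mk (k : ℕ) (g : ℤ_[p][X]) :
    omegaAlgEquiv p k (AdjoinRoot.mk _ g) = Ideal.Quotient.mk _ (g : IwasawaAlgebra p) :=
  rfl

/-- **The power basis `1, [T], …, [T]^{p^k-1}` of `Λ/(ω_k)` over `ℤ_p`**, transported from `AdjoinRoot.powerBasis'` along
`omegaAlgEquiv` (`Λ/(ω_k)` is free of rank `p^k` over `ℤ_p`). [cite: Washington1997, §7.1 (Prop. 7.2) and §13.2]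
[cite: Howard2004HeegnerKolyvagin, §2.2 Def. 2.2.1] -/
def omegaPowerBasis (k : ℕ) :
    PowerBasis ℤ_[p] (IwasawaAlgebra p ⧸ Ideal.span {((1 + PowerSeries.X : IwasawaAlgebra p) ^ (p ^ k) - 1)}) :=
  (AdjoinRoot.powerBasis' (Kato2004.IwasawaH1Exists.isDistinguishedAt_omega p k).monic).map (omegaAlgEquiv p k)

/-- The power basis has `p^k` elements. [cite: Washington1997, §7.1 (Prop. 7.2)] -/
@[simp]
theorem omegaPowerBasis_dim (k : ℕ) : (omegaPowerBasis p k).dim = p ^ k := by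
  rw [omegaPowerBasis, PowerBasis.map_dim, AdjoinRoot.powerBasis'_dim, natDegree_omegaPolynomial]

/-- Its generator is `[T]`. [cite: Washington1997, §7.1 (Prop. 7.2)] -/
@[simp]
theorem omegaPowerBasis_gen (k : ℕ) :
    (omegaPowerBasis p k).gen = Ideal.Quotient.mk _ (PowerSeries.X : IwasawaAlgebra p) := by
  rw [omegaPowerBasis, PowerBasis.map_gen, AdjoinRoot.powerBasis'_gen, AdjoinRoot.root, omegaAlgEquiv_mk, Polynomial.coe_X]

/-! ## §2 The ring maps around `Λ/(ω_k, p^k)`; characteristic `p^k`; `ℤ/p^k → Λ/(ω_k, p^k)` -/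

/-- **`Λ/(ω_k) ↠ Λ/(ω_k, p^k)`**, the reduction modulo `p^k` (Mathlib `Ideal.Quotient.factor`; `(ω_k) ≤ (ω_k, p^k) =
shapiroIdeal p k`). [cite: Howard2004HeegnerKolyvagin, §2.2 Def. 2.2.3 (𝐓/I_k 𝐓)] -/
def shapiroOfOmega (k : ℕ) :
    (IwasawaAlgebra p ⧸ Ideal.span {((1 + PowerSeries.X : IwasawaAlgebra p) ^ (p ^ k) - 1)}) →+*
      IwasawaAlgebra p ⧸ shapiroIdeal p k :=
  Ideal.Quotient.factor le_sup_left

/-- On classes: `shapiroOfOmega [x] = [x]`. [cite: Howard2004HeegnerKolyvagin, §2.2 Def. 2.2.3] -/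
@[simp]
theorem shapiroOfOmega_mk (k : ℕ) (x : IwasawaAlgebra p) :
    shapiroOfOmega p k (Ideal.Quotient.mk _ x) = Ideal.Quotient.mk _ x :=
  rfl

/-- `shapiroOfOmega` is surjective. [cite: Howard2004HeegnerKolyvagin, §2.2 Def. 2.2.3] -/
theorem shapiroOfOmega_surjective (k : ℕ) : Function.Surjective (shapiroOfOmega p k) :=
  Ideal.Quotient.factor_surjective _

/-- `shapiroOfOmega` is `ℤ_p`-linear: `[z • x] = z • [x]`. [cite: Howard2004HeegnerKolyvagin, §2.2 Def. 2.2.3] -/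
theorem shapiroOfOmega_smul (k : ℕ) (z : ℤ_[p])
    (x : IwasawaAlgebra p ⧸ Ideal.span {((1 + PowerSeries.X : IwasawaAlgebra p) ^ (p ^ k) - 1)}) :
    shapiroOfOmega p k (z • x) = z • shapiroOfOmega p k x := by
  obtain ⟨y, rfl⟩ := Ideal.Quotient.mk_surjective x
  rfl

/-- **`[F] ↦ F(0) mod p^k`**, a ring map `Λ/(ω_k, p^k) → ℤ/p^k` (`ω_k(0) = 0` and `p^k ↦ 0`).
[cite: Washington1997, §7.1 and §13.2] [cite: Howard2004HeegnerKolyvagin, §2.2 Def. 2.2.1] -/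
def shapiroEvalZero (k : ℕ) : (IwasawaAlgebra p ⧸ shapiroIdeal p k) →+* ZMod (p ^ k) :=
  Ideal.Quotient.lift _ ((PadicInt.toZModPow k).comp (PowerSeries.constantCoeff (R := ℤ_[p]))) fun a ha ↦ by
    refine (sup_le ?_ ?_ : shapiroIdeal p k ≤ RingHom.ker _) ha
    · rw [Ideal.span_le, Set.singleton_subset_iff, SetLike.mem_coe, RingHom.mem_ker, map_sub, map_pow, map_add,
        map_one, RingHom.comp_apply, PowerSeries.constantCoeff_X, map_zero, add_zero, one_pow, sub_self]
    · rw [Ideal.span_le, Set.singleton_subset_iff, SetLike.mem_coe, RingHom.mem_ker, map_pow, map_natCast,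
        ← Nat.cast_pow, ZMod.natCast_self]

/-- Unfolding: `shapiroEvalZero [F] = F(0) mod p^k`. [cite: Washington1997, §13.2] -/
@[simp]
theorem shapiroEvalZero_mk (k : ℕ) (F : IwasawaAlgebra p) :
    shapiroEvalZero p k (Ideal.Quotient.mk _ F) = PadicInt.toZModPow k (PowerSeries.constantCoeff F) :=
  rfl

/-- **`Λ/(ω_k, p^k)` has characteristic `p^k`**: `p^k = 0`, and if `n = 0` in `Λ/(ω_k, p^k)` then `n = 0` in `ℤ/p^k` (apply
`shapiroEvalZero`). [cite: Washington1997, §13.2 (Λ/(ω_n, p^k) = ℤ/p^k[Γ_n])] [cite: Howard2004HeegnerKolyvagin, §2.2 Def. 2.2.1] -/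
theorem charP_quotient_shapiroIdeal (k : ℕ) : CharP (IwasawaAlgebra p ⧸ shapiroIdeal p k) (p ^ k) := by
  refine ⟨fun x => ⟨fun hx => ?_, fun hdvd => ?_⟩⟩
  · have h := congrArg (shapiroEvalZero p k) hx
    rw [map_natCast, map_zero, ZMod.natCast_eq_zero_iff] at h
    exact h
  · obtain ⟨t, rfl⟩ := hdvd
    rw [Nat.cast_mul, ← map_natCast (Ideal.Quotient.mk (shapiroIdeal p k)) (p ^ k),
      Ideal.Quotient.eq_zero_iff_mem.mpr (by rw [Nat.cast_pow]; exact natCast_pow_mem_shapiroIdeal p k), zero_mul]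

/-- **`ι : ℤ/p^k →+* Λ/(ω_k, p^k)`**, the structure map of the `ℤ/p^k`-algebra `Λ/(ω_k, p^k)` (Mathlib `ZMod.castHom` at the
characteristic `p^k`). [cite: Washington1997, §13.2 (ℤ/p^k[Γ_n])] [cite: Howard2004HeegnerKolyvagin, §2.2 Def. 2.2.1] -/
def shapiroOfZMod (k : ℕ) : ZMod (p ^ k) →+* IwasawaAlgebra p ⧸ shapiroIdeal p k :=
  haveI := charP_quotient_shapiroIdeal p k
  ZMod.castHom (dvd_refl (p ^ k)) (IwasawaAlgebra p ⧸ shapiroIdeal p k)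

/-- `ι(x) = x.val` (as a natural-number cast). [cite: Washington1997, §13.2] -/
theorem shapiroOfZMod_apply (k : ℕ) (x : ZMod (p ^ k)) :
    shapiroOfZMod p k x = (x.val : IwasawaAlgebra p ⧸ shapiroIdeal p k) := by
  haveI := charP_quotient_shapiroIdeal p k
  rw [shapiroOfZMod, ZMod.castHom_apply, ZMod.cast_eq_val]

/-- **`ℤ_p → Λ/(ω_k, p^k)` factors through `ℤ/p^k`**: `algebraMap ℤ_[p] (Λ/I_k) z = ι(z mod p^k)`.
[cite: Washington1997, §13.2] [cite: Howard2004HeegnerKolyvagin, §2.2 Def. 2.2.1] -/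
theorem algebraMap_padicInt_quotient_shapiroIdeal (k : ℕ) (z : ℤ_[p]) :
    algebraMap ℤ_[p] (IwasawaAlgebra p ⧸ shapiroIdeal p k) z = shapiroOfZMod p k (PadicInt.toZModPow k z) := by
  obtain ⟨d, hd⟩ := Ideal.mem_span_singleton'.mp (PadicInt.appr_spec k z)
  have hz : z = ((z.appr k : ℕ) : ℤ_[p]) + d * (p : ℤ_[p]) ^ k := by rw [hd]; ring
  have htz : PadicInt.toZModPow k z = ((z.appr k : ℕ) : ZMod (p ^ k)) := rfl
  have hL : algebraMap ℤ_[p] (IwasawaAlgebra p ⧸ shapiroIdeal p k) z = Ideal.Quotient.mk _ (PowerSeries.C z) := by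
    rw [← Ideal.Quotient.mk_algebraMap, PowerSeries.algebraMap_eq]
  have hn : (Ideal.Quotient.mk (shapiroIdeal p k)) (PowerSeries.C ((z.appr k : ℕ) : ℤ_[p])) =
      ((z.appr k : ℕ) : IwasawaAlgebra p ⧸ shapiroIdeal p k) :=
    map_natCast ((Ideal.Quotient.mk _).comp (PowerSeries.C (R := ℤ_[p]))) (z.appr k)
  rw [htz, map_natCast (shapiroOfZMod p k), hL]
  conv_lhs => rw [hz]
  rw [map_add (PowerSeries.C (R := ℤ_[p])), map_add (Ideal.Quotient.mk _), hn, add_eq_left,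
    map_mul (PowerSeries.C (R := ℤ_[p])), map_pow, map_natCast, Ideal.Quotient.eq_zero_iff_mem]
  exact Ideal.mul_mem_left _ _ (natCast_pow_mem_shapiroIdeal p k)

/-- `z • a = ι(z mod p^k) * a` on `Λ/(ω_k, p^k)` for `z ∈ ℤ_p`. [cite: Washington1997, §13.2] -/
theorem padicInt_smul_eq_shapiroOfZMod_mul (k : ℕ) (z : ℤ_[p]) (a : IwasawaAlgebra p ⧸ shapiroIdeal p k) :
    z • a = shapiroOfZMod p k (PadicInt.toZModPow k z) * a := by
  obtain ⟨y, rfl⟩ := Ideal.Quotient.mk_surjective a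
  rw [← algebraMap_padicInt_quotient_shapiroIdeal, ← Ideal.Quotient.mk_algebraMap, PowerSeries.algebraMap_eq,
    ← map_mul, ← PowerSeries.smul_eq_C_mul]
  rfl

/-! ## §3 The tail form of `Λ/(ω_k, p^k)` with values in `ℤ/p^k` -/

/-- The `ℤ`-linear functional `Λ → ℤ/p^k`, `x ↦ λ_ω([x]) mod p^k` (auxiliary: it descends to `Λ/(ω_k, p^k)`).
[cite: Howard2004HeegnerKolyvagin, §2.1 (the map 𝒟_𝔭 → ℚ_p/ℤ_p) and Prop. 2.2.4] -/
def shapiroTailFormModPow (k : ℕ) : IwasawaAlgebra p →ₗ[ℤ] ZMod (p ^ k) :=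
  (PadicInt.toZModPow k : ℤ_[p] →+* ZMod (p ^ k)).toAddMonoidHom.toIntLinearMap ∘ₗ
    ((tailForm (omegaPowerBasis p k)).restrictScalars ℤ ∘ₗ
      (Ideal.Quotient.mk (Ideal.span {((1 + PowerSeries.X : IwasawaAlgebra p) ^ (p ^ k) - 1)})).toAddMonoidHom.toIntLinearMap)

/-- Unfolding: `shapiroTailFormModPow x = λ_ω([x]) mod p^k`. [cite: Howard2004HeegnerKolyvagin, §2.1] -/
@[simp]
theorem shapiroTailFormModPow_apply (k : ℕ) (x : IwasawaAlgebra p) :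
    shapiroTailFormModPow p k x = PadicInt.toZModPow k (tailForm (omegaPowerBasis p k) (Ideal.Quotient.mk _ x)) :=
  rfl

/-- The ideal `(ω_k, p^k)` is killed by `shapiroTailFormModPow`. [cite: Howard2004HeegnerKolyvagin, §2.1 and §2.2 Def. 2.2.3] -/
theorem shapiroIdeal_le_ker_shapiroTailFormModPow (k : ℕ) :
    (shapiroIdeal p k).restrictScalars ℤ ≤ LinearMap.ker (shapiroTailFormModPow p k) := by
  intro x hx
  rw [Submodule.restrictScalars_mem] at hx
  rw [LinearMap.mem_ker, shapiroTailFormModPow_apply]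
  obtain ⟨a, ha, b, hb, rfl⟩ := Submodule.mem_sup.mp hx
  obtain ⟨g, rfl⟩ := Ideal.mem_span_singleton'.mp hb
  have ha0 : (Ideal.Quotient.mk (Ideal.span {((1 + PowerSeries.X : IwasawaAlgebra p) ^ (p ^ k) - 1)}) a) = 0 :=
    Ideal.Quotient.eq_zero_iff_mem.mpr ha
  have hC : (Ideal.Quotient.mk (Ideal.span {((1 + PowerSeries.X : IwasawaAlgebra p) ^ (p ^ k) - 1)})
      (g * (p : IwasawaAlgebra p) ^ k)) = ((p : ℤ_[p]) ^ k) • Ideal.Quotient.mk _ g := by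
    rw [mul_comm, ← map_natCast (PowerSeries.C (R := ℤ_[p])) p, ← map_pow, ← PowerSeries.smul_eq_C_mul]
    rfl
  rw [map_add, ha0, zero_add, hC, LinearMap.map_smul, smul_eq_mul]
  exact toZModPow_natCast_pow_mul p k _

/-- **The tail form of `Λ/(ω_k, p^k)`**: the additive (`ℤ`-linear) functional `λ_k : Λ/(ω_k, p^k) → ℤ/p^k`,
`λ_k([x]) = λ_ω([x]) mod p^k` — the Frobenius form of the `ℤ/p^k`-algebra `(ℤ/p^k)[T]/(ω_k)` (coefficient of `T^{p^k − 1}`).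
[cite: Howard2004HeegnerKolyvagin, §2.1 (the map 𝒟_𝔭 → ℚ_p/ℤ_p) and Prop. 2.2.4] [cite: DeSmitRubinSchoof1997, Prop. 2.1 (case n = 1)] -/
def shapiroTailFormZMod (k : ℕ) : (IwasawaAlgebra p ⧸ shapiroIdeal p k) →ₗ[ℤ] ZMod (p ^ k) :=
  ((Submodule.restrictScalars ℤ (shapiroIdeal p k)).liftQ (shapiroTailFormModPow p k)
      (shapiroIdeal_le_ker_shapiroTailFormModPow p k)) ∘ₗ
    (Submodule.Quotient.restrictScalarsEquiv ℤ (shapiroIdeal p k)).symm.toLinearMap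

/-- **Unfolding**: `λ_k([x]) = λ_ω([x]) mod p^k`. [cite: Howard2004HeegnerKolyvagin, §2.1] -/
@[simp]
theorem shapiroTailFormZMod_mk (k : ℕ) (x : IwasawaAlgebra p) :
    shapiroTailFormZMod p k (Ideal.Quotient.mk _ x) =
      PadicInt.toZModPow k (tailForm (omegaPowerBasis p k) (Ideal.Quotient.mk _ x)) := by
  rw [shapiroTailFormZMod, LinearMap.comp_apply]
  change ((Submodule.restrictScalars ℤ _).liftQ (shapiroTailFormModPow p k) _)
    ((Submodule.Quotient.restrictScalarsEquiv ℤ _).symm (Submodule.Quotient.mk x)) = _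
  rw [Submodule.Quotient.restrictScalarsEquiv_symm_mk, Submodule.liftQ_apply, shapiroTailFormModPow_apply]

/-- `λ_k(shapiroOfOmega y) = λ_ω(y) mod p^k`. [cite: Howard2004HeegnerKolyvagin, §2.1] -/
theorem shapiroTailFormZMod_shapiroOfOmega (k : ℕ)
    (y : IwasawaAlgebra p ⧸ Ideal.span {((1 + PowerSeries.X : IwasawaAlgebra p) ^ (p ^ k) - 1)}) :
    shapiroTailFormZMod p k (shapiroOfOmega p k y) = PadicInt.toZModPow k (tailForm (omegaPowerBasis p k) y) := by
  obtain ⟨x, rfl⟩ := Ideal.Quotient.mk_surjective y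
  rw [shapiroOfOmega_mk, shapiroTailFormZMod_mk]

/-! ## §4 The dual families `[T^i]`, `[xᵢ^*]` and the two Frobenius identities -/

/-- **The power family `[T^i] ∈ Λ/(ω_k, p^k)`, `i < p^k`.** [cite: Washington1997, §13.2] [cite: Howard2004HeegnerKolyvagin, §2.2 Def. 2.2.1] -/
def shapiroPowFamily (k : ℕ) (i : Fin (p ^ k)) : IwasawaAlgebra p ⧸ shapiroIdeal p k :=
  Ideal.Quotient.mk _ ((PowerSeries.X : IwasawaAlgebra p) ^ (i : ℕ))

/-- **The dual family `[xᵢ^*] ∈ Λ/(ω_k, p^k)`, `i < p^k`**: the image of the tail-dual basis of `Λ/(ω_k)` (tree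
`tailDualBasis (omegaPowerBasis p k)`). [cite: DeSmitRubinSchoof1997, Cor. 2.2 (case n = 1)] [cite: Howard2004HeegnerKolyvagin, §2.1] -/
def shapiroDualFamily (k : ℕ) (i : Fin (p ^ k)) : IwasawaAlgebra p ⧸ shapiroIdeal p k :=
  shapiroOfOmega p k (tailDualBasis (omegaPowerBasis p k) (Fin.cast (omegaPowerBasis_dim p k).symm i))

/-- `[T^i]` is the image of the `i`-th power of the generator of the power basis. [cite: Washington1997, §13.2] -/
theorem shapiroPowFamily_eq (k : ℕ) (i : Fin (p ^ k)) :
    shapiroPowFamily p k i = shapiroOfOmega p k ((omegaPowerBasis p k).gen ^ (i : ℕ)) := by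
  rw [omegaPowerBasis_gen, ← map_pow, shapiroOfOmega_mk, shapiroPowFamily]

/-- **Duality `λ_k([T^i] [xⱼ^*]) = δᵢⱼ`** (the hypothesis `hδ` of `scalarForm_bijective_of_expansion`).
[cite: DeSmitRubinSchoof1997, Cor. 2.2 (case n = 1)] [cite: Howard2004HeegnerKolyvagin, §2.1 and Prop. 2.2.4] -/
theorem shapiroTailFormZMod_powFamily_mul_dualFamily (k : ℕ) (i j : Fin (p ^ k)) :
    shapiroTailFormZMod p k (shapiroPowFamily p k i * shapiroDualFamily p k j) = if i = j then 1 else 0 := by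
  have h : tailForm (omegaPowerBasis p k) (tailDualBasis (omegaPowerBasis p k)
      (Fin.cast (omegaPowerBasis_dim p k).symm j) * (omegaPowerBasis p k).gen ^ (i : ℕ)) =
      if Fin.cast (omegaPowerBasis_dim p k).symm i = Fin.cast (omegaPowerBasis_dim p k).symm j then 1 else 0 :=
    tailForm_tailDualBasis_mul_pow (omegaPowerBasis p k) (Fin.cast (omegaPowerBasis_dim p k).symm j)
      (Fin.cast (omegaPowerBasis_dim p k).symm i)
  rw [shapiroPowFamily_eq, shapiroDualFamily, ← map_mul, shapiroTailFormZMod_shapiroOfOmega, mul_comm, h]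
  by_cases hij : i = j
  · subst hij; rw [if_pos rfl, if_pos rfl, map_one]
  · rw [if_neg (fun h => hij (Fin.cast_injective _ h)), if_neg hij, map_zero]

/-- **Expansion `c = ∑ᵢ ι(λ_k(c [xᵢ^*])) [T^i]`** of every `c ∈ Λ/(ω_k, p^k)` (the hypothesis `hexp` of
`scalarForm_bijective_of_expansion`; from `y = ∑ᵢ λ_ω(xᵢ^* y) • [T]^i` in `Λ/(ω_k)` and `z • a = ι(z mod p^k) a`).
[cite: DeSmitRubinSchoof1997, Cor. 2.2 (case n = 1)] [cite: Howard2004HeegnerKolyvagin, §2.1 and Prop. 2.2.4] -/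
theorem eq_sum_shapiroOfZMod_tailFormZMod_mul_powFamily (k : ℕ) (c : IwasawaAlgebra p ⧸ shapiroIdeal p k) :
    c = ∑ i : Fin (p ^ k), shapiroOfZMod p k (shapiroTailFormZMod p k (c * shapiroDualFamily p k i)) * shapiroPowFamily p k i := by
  obtain ⟨y, rfl⟩ := shapiroOfOmega_surjective p k c
  set pb := omegaPowerBasis p k with hpb
  have hdim : pb.dim = p ^ k := omegaPowerBasis_dim p k
  have hS : shapiroOfOmega p k y =
      ∑ i : Fin pb.dim, shapiroOfOmega p k (tailForm pb (tailDualBasis pb i * y) • pb.gen ^ (i : ℕ)) := by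
    conv_lhs => rw [← sum_tailForm_tailDualBasis_mul_smul_pow pb y]
    rw [map_sum]
  conv_lhs => rw [hS, ← (Fin.castOrderIso hdim.symm).toEquiv.sum_comp]
  refine Finset.sum_congr rfl fun i _ => ?_
  have hc : ((Fin.cast hdim.symm i : Fin pb.dim) : ℕ) = (i : ℕ) := rfl
  rw [RelIso.coe_fn_toEquiv, Fin.castOrderIso_apply, shapiroOfOmega_smul, padicInt_smul_eq_shapiroOfZMod_mul, hc,
    shapiroDualFamily, ← map_mul, shapiroTailFormZMod_shapiroOfOmega, mul_comm y, shapiroPowFamily_eq]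

end Literature.NumberTheory.EllipticCurves.ZpExtension
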